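import Mathlib
import Summits.AtomisticToContinuum.FouriersLaw.Theses.MatthiessenLadder

/-! Redirect strategist r1 — typed S⁺ / split candidates for the census of crux `PrefixIncrementBounds`
(stmt-AtomisticToContinuum-12776). Signatures only (they must elaborate; nothing is claimed). -/

namespace Summit.AtomisticToContinuum.FouriersLaw.Cruxes.PrefixIncrementBounds.StrategyCensusR1

open Literature.MathematicalPhysics.KineticTheory.HeatConduction
open Summit.AtomisticToContinuum.FouriersLaw.Theses.MatthiessenLadder

/-- S⁺_mono — MONOTONE LADDER (sign-only strengthening of the lower half: switching on one more quartic cell never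
raises the conductance, at every interface position, `N ≥ N₀`). -/
def MonotoneLadder : Prop :=
  ∀ ω₂ lam β γ : ℝ, 0 < ω₂ → 0 < lam → 0 < β → 0 < γ → ∀ T : ℝ, 0 < T → ∃ N₀ : ℕ, ∀ N k : ℕ, N₀ ≤ N → k < N →
    ∀ D₀ D₁ : ℝ, (cellChain ω₂ lam β γ (fun i => decide (i < k))).IsResponseCoeff N T D₀ →
      (cellChain ω₂ lam β γ (fun i => decide (i < k + 1))).IsResponseCoeff N T D₁ → 0 < D₁ ∧ D₁ ≤ D₀

/-- S⁺_lead — LEAD LOCALITY (the increment at interface `k` is exponentially insensitive to the length `N-1-k` of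
the ballistic harmonic lead on its right). -/
def LeadLocality : Prop :=
  ∀ ω₂ lam β γ : ℝ, 0 < ω₂ → 0 < lam → 0 < β → 0 < γ → ∀ T : ℝ, 0 < T → ∃ C ξ : ℝ, 0 < ξ ∧ ∃ N₀ : ℕ,
    ∀ N N' k : ℕ, N₀ ≤ N → N ≤ N' → k < N → ∀ D₀ D₁ D₀' D₁' : ℝ,
      (cellChain ω₂ lam β γ (fun i => decide (i < k))).IsResponseCoeff N T D₀ →
      (cellChain ω₂ lam β γ (fun i => decide (i < k + 1))).IsResponseCoeff N T D₁ →
      (cellChain ω₂ lam β γ (fun i => decide (i < k))).IsResponseCoeff N' T D₀' →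
      (cellChain ω₂ lam β γ (fun i => decide (i < k + 1))).IsResponseCoeff N' T D₁' →
      |(((N : ℝ) - 1) / D₁ - ((N : ℝ) - 1) / D₀) - (((N' : ℝ) - 1) / D₁' - ((N' : ℝ) - 1) / D₀')|
        ≤ C * Real.exp (-(((N : ℝ) - 1 - k) / ξ))

/-- S⁺_block — BLOCK LOCALITY (two-sided translation invariance of the bulk increment: the increments at `(N, k)`
and `(N', k')` differ by at most `C (e^{-min(k,k')/ξ} + e^{-min(N-1-k, N'-1-k')/ξ})`). Implies `PrefixIncrementLimit`
minus the sign of the limit; the sign would come from ONE finite window `(2m₀+1, m₀)` — see `FiniteWindowQuantum`. -/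
def BlockLocality : Prop :=
  ∀ ω₂ lam β γ : ℝ, 0 < ω₂ → 0 < lam → 0 < β → 0 < γ → ∀ T : ℝ, 0 < T → ∃ C ξ : ℝ, 0 < ξ ∧ ∃ N₀ : ℕ,
    ∀ N N' k k' : ℕ, N₀ ≤ N → N₀ ≤ N' → k < N → k' < N' → ∀ D₀ D₁ D₀' D₁' : ℝ,
      (cellChain ω₂ lam β γ (fun i => decide (i < k))).IsResponseCoeff N T D₀ →
      (cellChain ω₂ lam β γ (fun i => decide (i < k + 1))).IsResponseCoeff N T D₁ →
      (cellChain ω₂ lam β γ (fun i => decide (i < k'))).IsResponseCoeff N' T D₀' →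
      (cellChain ω₂ lam β γ (fun i => decide (i < k' + 1))).IsResponseCoeff N' T D₁' →
      |(((N : ℝ) - 1) / D₁ - ((N : ℝ) - 1) / D₀) - (((N' : ℝ) - 1) / D₁' - ((N' : ℝ) - 1) / D₀')|
        ≤ C * (Real.exp (-((min k k' : ℕ) : ℝ) / ξ) +
               Real.exp (-((min (N - 1 - k) (N' - 1 - k') : ℕ) : ℝ) / ξ))

/-- The FIXED-SIZE companion of `BlockLocality`: one window `(2m₀+1, m₀)` whose increment beats the locality error.
The constants `C, ξ` are those OF `BlockLocality`, so as a stand-alone item it must quantify over them — which makes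
it uniform in `m` again (`∀ C ξ, ∃ m₀ …` is a liminf statement over a family of finite systems). -/
def FiniteWindowQuantum : Prop :=
  ∀ ω₂ lam β γ : ℝ, 0 < ω₂ → 0 < lam → 0 < β → 0 < γ → ∀ T : ℝ, 0 < T → ∀ C ξ : ℝ, 0 < ξ → ∃ m₀ : ℕ, ∃ q : ℝ,
    2 * C * Real.exp (-(m₀ : ℝ) / ξ) < q ∧ ∀ D₀ D₁ : ℝ,
      (cellChain ω₂ lam β γ (fun i => decide (i < m₀))).IsResponseCoeff (2 * m₀ + 1) T D₀ →
      (cellChain ω₂ lam β γ (fun i => decide (i < m₀ + 1))).IsResponseCoeff (2 * m₀ + 1) T D₁ →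
      0 < D₀ ∧ 0 < D₁ ∧ q ≤ (2 * (m₀ : ℝ)) / D₁ - (2 * (m₀ : ℝ)) / D₀

/-- S⁺_profile — PROFILE-UNIFORM INCREMENTS (the card's arbitrary-Λ form): for EVERY cell profile `c` and every
site `x` carrying at least `k₀` switched-on cells immediately to its left, switching `x` on changes the resistance by
an amount in `[r_min, r_max]`, `N`-uniformly. -/
def ProfileUniformIncrements : Prop :=
  ∀ ω₂ lam β γ : ℝ, 0 < ω₂ → 0 < lam → 0 < β → 0 < γ → ∀ T : ℝ, 0 < T → ∃ rmin rmax : ℝ, 0 < rmin ∧ rmin ≤ rmax ∧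
    ∃ k₀ N₀ : ℕ, ∀ (c : ℕ → Bool) (N x : ℕ), N₀ ≤ N → k₀ ≤ x → x + k₀ < N → (∀ i, x - k₀ ≤ i → i < x → c i = true) →
      c x = false → ∀ D₀ D₁ : ℝ,
        (cellChain ω₂ lam β γ c).IsResponseCoeff N T D₀ →
        (cellChain ω₂ lam β γ (Function.update c x true)).IsResponseCoeff N T D₁ →
        0 < D₀ ∧ 0 < D₁ ∧ rmin ≤ ((N : ℝ) - 1) / D₁ - ((N : ℝ) - 1) / D₀ ∧ ((N : ℝ) - 1) / D₁ - ((N : ℝ) - 1) / D₀ ≤ rmax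

/-- PIB is contained in the profile-uniform form only up to the upper-bound regime (contacts); recorded, not used. -/
example : True := trivial

end Summit.AtomisticToContinuum.FouriersLaw.Cruxes.PrefixIncrementBounds.StrategyCensusR1
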